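import Summits.CriticalPhenomena.CardyFormulaZ2.Theses.CardyHausdorffMoment

/-!
# Birth skeleton `birth` for crux `ConfInvTransport` (stmt-CriticalPhenomena-0794)

Route `CardyHausdorffMoment` (primary; the crux is SHARED verbatim with `CardyHarmonicInvariants`,
`CardyOrderDuality`, `CardyMonotoneApproach`, `CardyUniqueLimit`), sub-problem `CardyFormulaZ2`.
Skeleton registrar `planner-skel-stmt-CriticalPhenomena-0794-0`, 2026-08-17. Tree path
`Summits/CriticalPhenomena/CardyFormulaZ2/Cruxes/ConfInvTransport/Lines/birth.lean`.
THREE registered stubs `stub_rectilinearInvariance`, `stub_domainContinuity`,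
`stub_rectilinearRealisation` (sorried; signatures spelled out over tree declarations) and the
sorry-free composition `ConfInvTransport_of`, whose conclusion is literally the route decl
`Summit.CriticalPhenomena.CardyFormulaZ2.Theses.CardyHausdorffMoment.ConfInvTransport`.

## The crux

`ConfInvTransport` (conformal invariance of bond-ℤ² crossing limits, TRANSPORT form): for conformal
rectangles `R`, `R'` with uniformizing data `(φ, x)`, `(φ', x')` of equal Cardy cross-ratio
`crossRatio x = crossRatio x'`, every limit `L` of `δ ↦ bondDomainCrossingProb R δ` along `δ → 0⁺`
is also the limit of `δ ↦ bondDomainCrossingProb R' δ`. No existence of any limit is asserted by the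
crux, and none is asserted by the stubs below: the whole line is LIMIT-FREE (asymptotic statements
about differences of lattice crossing probabilities, in the style of DKKMO's rotation invariance,
arXiv:2012.11672 Thm 1.2, which is proved without knowing that the scaling limit exists).

## The line in one paragraph (structured dense class + mesh-uniform continuity + exact-modulus density)

Write `P_δ(R) = bondDomainCrossingProb R δ`. Conformal transport for ALL pairs of Jordan conformal
rectangles is cut along the class of RECTILINEAR conformal rectangles (Jordan boundary inside
finitely many axis-parallel segments — the class of the sibling items
`CardyBoundaryCoulombGas.RectilinearCardy/RectilinearSuffices`, dense in the marked-loop topology by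
the tree theorem `Summit.CriticalPhenomena.CardyFormulaZ2.Theorems.exists_rectilinear_close`):

* **S1 `stub_rectilinearInvariance` (the HEART; open-problem class, XL).** Asymptotic conformal
  invariance on rectilinear pairs: if `Q`, `Q'` are rectilinear with uniformizing data of equal
  cross-ratio then `P_δ(Q) - P_δ(Q') → 0` as `δ → 0⁺`. All the conformal content of the crux, but on
  domains with flat axis-parallel boundary pieces (Schwarz–Christoffel structure, lattice-aligned
  boundary conditions for the ℤ² transfer matrix / boundary Coulomb gas, exact quarter-turn symmetry)
  and in DIFFERENCE form (no limit on either side is assumed or produced).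
* **S2 `stub_domainContinuity` (a-priori estimate, percolation, L).** Mesh-uniform continuity of the
  lattice crossing probability in the marked-loop topology: for every `R` and `τ > 0` there is
  `ε₀ > 0` such that every conformal rectangle `Q` whose boundary loop is pointwise `ε₀`-close to
  that of `R` (as parametrised loops) and whose mark parameters are `ε₀`-close satisfies
  `|P_δ(Q) - P_δ(R)| ≤ τ` for all sufficiently small `δ` (the range of `δ` may depend on `Q`).
  RSW technology only (Schramm–Smirnov 2011 Lemma 5.1 / eq. (5.1), DISCHARGED in the tree as
  `SchrammSmirnov2011_lemma_5_1_holds` with the lattice-uniform corollary `continuity_of_lemma_5_1`,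
  plus the dictionary between Schramm–Smirnov quad crossings and G02's `discreteCrossing`); it is
  also a consequence of the conjunct itself (Radó + continuity of `F`), so it cannot be refuted
  unless `CardyFormulaZ2` is. No conformal invariance is used or produced.
* **S3 `stub_rectilinearRealisation` (complex analysis, model-free, provable now, M–L).** Exact-modulus
  rectilinear approximation: every conformal rectangle `R` with datum `(φ, x)` has, for every
  `ε₀ > 0`, a rectilinear `Q` with a datum `(ψ, y)`, loop and marks `ε₀`-close to those of `R`, and
  `crossRatio y = crossRatio x` EXACTLY. Plan: `exists_rectilinear_close` (same marks, `ε`-close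
  loops), Radó (`ConformalRectangle.tendsto_crossRatio_of_tendsto_mark`) and sliding the mark
  parameter `mark 1` inside `(mark 0, mark 2)` — the cross-ratio is continuous and strictly
  increasing in it and sweeps `(0, 1)` — with the intermediate value theorem; data by
  `MarkedDomain.exists_isUniformizing_holds`, well-definedness by `crossRatio_eq_of_isUniformizing_holds`.

Composition (`ConfInvTransport_of`, proved below from the abstract four-corner lemma
`tendsto_of_approximants`): given `R, R'` of common modulus `η` and `P_δ(R) → L`, fix `τ > 0`;
S2 gives closeness scales `ε₀`, `ε₀'` at `R`, `R'` for `τ/4`; S3 gives rectilinear `Q`, `Q'` that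
close, both of modulus EXACTLY `η`; S1 gives `P_δ(Q) - P_δ(Q') → 0`; hence eventually
`|P_δ(R') - L| ≤ |P_δ(R') - P_δ(Q')| + |P_δ(Q') - P_δ(Q)| + |P_δ(Q) - P_δ(R)| + |P_δ(R) - L| < τ`.

## Disproof used / dead lines / negatives

`Cruxes/ConfInvTransport/` had no workfiles at registration (`ledger crux ls stmt-CriticalPhenomena-0794`:
"(no workfiles yet)"; no `Disproof.lean`, no `Lines/*.dead.md`, no landed
`Theorems/ConfInvTransport/Negative/*`): nothing to honour or import. Negatives index of the summit
(`ledger negatives --problem CriticalPhenomena`, 11 entries) checked: no stub is an instance of a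
refuted statement — the refuted curve-level `CardyRotToConfR2SymmetryUpgrade` (stmt-0698) is an
axiomatic statement about Markov chordal families WITHOUT a lattice clause, whereas S1–S3 speak of the
bond-ℤ² lattice probabilities `bondDomainCrossingProb` (S1, S2) or of pure conformal geometry (S3);
stmt-0748 (`NegDegenerateArcs`, refuted by RSW: cluster points of `P_δ(R)` lie in `(0,1)`) is
consistent with, indeed of the same technology as, S2.

## Barriers

`Literature.Barriers.CriticalPhenomena.EmbeddingModulusUniqueness` (Beffara Prop. 4: embedding-blind
arguments give no conformal invariance) bears on S1 only, and S1 does not evade it: the bet — the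
route header's own — is that the axis-parallel class lets embedding-SPECIFIC inputs in (flat
lattice-aligned boundary, the square embedding's exact duality and quarter-turn symmetry, DKKMO
rotations `dkkmo_theorem_1_2`); S2/S3 claim no symmetry and are outside the barrier's class
(its `blocks` field exempts existence/continuity statements). `SmirnovTriangularOnly`,
`CoveringLatticeShift`: nothing transplanted from the triangular lattice, no covering-lattice exchange.
-/

noncomputable section

namespace Summit.CriticalPhenomena.CardyFormulaZ2.Cruxes.ConfInvTransport.Birth

open Filter Topology Set
open Literature.Probability.RandomPlanarGeometry
open Literature.Probability.Percolation (bondDomainCrossingProb)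

/-! ### Registered stubs (signatures spelled out in full over tree declarations) -/

/-- **stub_rectilinearInvariance (S1, the HEART; open-problem class, size XL).** If `Q`, `Q'` are
rectilinear conformal rectangles (Jordan boundary inside finitely many axis-parallel segments) with
uniformizing data `(ψ, y)`, `(ψ', y')` of equal Cardy cross-ratio, then the bond-ℤ² crossing
probabilities are asymptotically equal: `bondDomainCrossingProb Q δ - bondDomainCrossingProb Q' δ → 0`
as `δ → 0⁺`. Why plausibly true: it is implied by the conjunct (both sides tend to `F(η)`); it is the
exact analogue, for conformal self-maps of the rectilinear class, of DKKMO's rotation statement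
(arXiv:2012.11672 Thm 1.2, `Literature.Probability.Percolation.dkkmo_theorem_1_2`), which is limit-free
in the same way. Why it might fail / why open: it IS conformal invariance of bond-ℤ² crossing
probabilities (Schramm2007ICM Problem 2.11) on a subclass; no embedding-blind proof exists
(`Literature.Barriers.CriticalPhenomena.EmbeddingModulusUniqueness`, Beffara2008Universal Prop. 4);
the bet is the lattice-aligned boundary (Schwarz–Christoffel with right angles, ℤ² transfer matrix
with flat boundary conditions, quarter-turn symmetry + DKKMO rotations as the symmetry-upgrade input).
[cite: Schramm2007ICM, §2.6 Problem 2.11] [cite: DKKMO2020Rotational, Thm 1.2]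
[cite: Beffara2008Universal, Prop. 4] [cite: Smirnov2001, Thm 1 and closing remark] -/
theorem stub_rectilinearInvariance :
    ∀ (Q Q' : Literature.Probability.RandomPlanarGeometry.ConformalRectangle), (∃ S : Finset (ℂ × ℂ), (∀ p ∈ S, p.1.re = p.2.re ∨ p.1.im = p.2.im) ∧ frontier Q.carrier ⊆ ⋃ p ∈ S, segment ℝ p.1 p.2) → (∃ S : Finset (ℂ × ℂ), (∀ p ∈ S, p.1.re = p.2.re ∨ p.1.im = p.2.im) ∧ frontier Q'.carrier ⊆ ⋃ p ∈ S, segment ℝ p.1 p.2) → ∀ (ψ : Literature.Probability.RandomPlanarGeometry.ConformalEquiv UpperHalfPlane.upperHalfPlaneSet Q.carrier) (y : Fin 4 → ℝ) (ψ' : Literature.Probability.RandomPlanarGeometry.ConformalEquiv UpperHalfPlane.upperHalfPlaneSet Q'.carrier) (y' : Fin 4 → ℝ), Q.IsUniformizing ψ y → Q'.IsUniformizing ψ' y' → Literature.Probability.RandomPlanarGeometry.crossRatio y = Literature.Probability.RandomPlanarGeometry.crossRatio y' → Filter.Tendsto (fun δ : ℝ ↦ Literature.Probability.Percolation.bondDomainCrossingProb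 Q δ - Literature.Probability.Percolation.bondDomainCrossingProb Q' δ) (nhdsWithin (0 : ℝ) (Set.Ioi 0)) (nhds 0) := by
  sorry

/-- **stub_domainContinuity (S2, size L; a-priori estimate, RSW technology, no conformal input).**
For every conformal rectangle `R` and `τ > 0` there is `ε₀ > 0` such that every conformal rectangle
`Q` with boundary loop pointwise `ε₀`-close to `R.boundary` (as parametrised loops) and mark
parameters `ε₀`-close to `R.mark` has `|bondDomainCrossingProb Q δ - bondDomainCrossingProb R δ| ≤ τ`
for all sufficiently small meshes `δ` (how small may depend on `Q`). Why plausibly true: RSW + the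
half-plane three-arm "no jump" under small moves of the boundary, i.e. Schramm–Smirnov 2011 Lemma 5.1
and eq. (5.1) — DISCHARGED in the tree (`SchrammSmirnov2011_lemma_5_1_holds`, lattice-uniform form
`Literature.Probability.Percolation.QuadCrossing.Quad.continuity_of_lemma_5_1`: quads `Q' < Q₀ < Q''` with
`P[Q' crossed, Q'' not] ≤ ε` for all small meshes) — transported from Schramm–Smirnov quad crossings to
G02's `discreteCrossing` (largest component of `Ω ∩ δℤ²`, distance-defined discrete arcs) and from the
quad metric to the marked-loop topology (Radó: `JordanDomain.rado_tendstoUniformlyOn_holds`). It is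
moreover a consequence of the conjunct (`F ∘ η` is loop-continuous by
`ConformalRectangle.tendsto_crossRatio_of_tendsto_mark` + `continuousOn_cardyFunction_Ioo`). Why it
might fail: only through the discretisation conventions on wild Jordan boundaries (discrete arcs near
marks sitting in fjords of width `≪ ε₀`), the same exposure as the conjunct's.
[cite: SchrammSmirnov2011, Lemma 5.1 and eq. (5.1)] [cite: CamiaNewman2007, Thm 3 and §6]
[cite: BollobasRiordan2006, Ch. 7] -/
theorem stub_domainContinuity :
    ∀ R : Literature.Probability.RandomPlanarGeometry.ConformalRectangle, ∀ τ : ℝ, 0 < τ → ∃ ε₀ : ℝ, 0 < ε₀ ∧ ∀ Q : Literature.Probability.RandomPlanarGeometry.ConformalRectangle, (∀ u : ℝ, dist (Q.boundary u) (R.boundary u) ≤ ε₀) → (∀ i : Fin 4, |Q.mark i - R.mark i| ≤ ε₀) → ∀ᶠ δ in nhdsWithin (0 : ℝ) (Set.Ioi 0), |Literature.Probability.Percolation.bondDomainCrossingProb Q δ - Literature.Probability.Percolation.bondDomainCrossingProb R δ| ≤ τ := by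
  sorry

/-- **stub_rectilinearRealisation (S3, size M–L; pure conformal geometry, provable now from tree
theorems).** For every conformal rectangle `R` with uniformizing datum `(φ, x)` and every `ε₀ > 0`
there is a RECTILINEAR conformal rectangle `Q` with a uniformizing datum `(ψ, y)` such that the
boundary loop of `Q` is pointwise `ε₀`-close to that of `R`, the mark parameters are `ε₀`-close, and
`crossRatio y = crossRatio x` EXACTLY. Plan: `P` from `Theorems.exists_rectilinear_close` (same marks,
`ε`-close loops) has modulus `η_P → η_R` as `ε → 0` (Radó, `ConformalRectangle.tendsto_crossRatio_of_tendsto_mark`);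
slide the parameter `mark 1` of `P` inside `(mark 0, mark 2)`: the modulus of the re-marked domain is
continuous in it (Radó again, fixed loop) and, for `R` itself, strictly increasing (five-point
uniformization `MarkedDomain.exists_isUniformizing_holds (n := 5)` + `restrictMarks` +
`∂η/∂x₁ = (x₃ - x₀)(x₃ - x₂)/((x₂ - x₀)(x₃ - x₁)²) > 0`), so two nearby parameters `s₋ < mark 1 < s₊`
bracket `η_R` for `R`, hence for `P` once `ε` is small, and the intermediate value theorem gives a
parameter in `(s₋, s₊)` realising `η_R` exactly; data exist by `exists_isUniformizing_holds`, the
modulus is datum-independent by `crossRatio_eq_of_isUniformizing_holds`. Why it might fail: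
formalisation only. [cite: PommerenkeBBCM1992, Thm. 2.11 and Cor. 2.4] [cite: Ahlfors1979, Ch. 6 §1.1] -/
theorem stub_rectilinearRealisation :
    ∀ (R : Literature.Probability.RandomPlanarGeometry.ConformalRectangle) (φ : Literature.Probability.RandomPlanarGeometry.ConformalEquiv UpperHalfPlane.upperHalfPlaneSet R.carrier) (x : Fin 4 → ℝ), R.IsUniformizing φ x → ∀ ε₀ : ℝ, 0 < ε₀ → ∃ (Q : Literature.Probability.RandomPlanarGeometry.ConformalRectangle) (ψ : Literature.Probability.RandomPlanarGeometry.ConformalEquiv UpperHalfPlane.upperHalfPlaneSet Q.carrier) (y : Fin 4 → ℝ), (∃ S : Finset (ℂ × ℂ), (∀ p ∈ S, p.1.re = p.2.re ∨ p.1.im = p.2.im) ∧ frontier Q.carrier ⊆ ⋃ p ∈ S, segment ℝ p.1 p.2) ∧ Q.IsUniformizing ψ y ∧ (∀ u : ℝ, dist (Q.boundary u) (R.boundary u) ≤ ε₀) ∧ (∀ i : Fin 4, |Q.mark i - R.mark i| ≤ ε₀) ∧ Literature.Probability.RandomPlanarGeometry.crossRatio y = Literature.Probability.RandomPlanarGeometry.crossRatio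 x := by
  sorry

/-! ### Name-keyed statements of the three stubs

The hypotheses of the composition `ConfInvTransport_of`: the skeleton audit admits a hypothesis only
if its head constant is a registered obligation or is named like a declared stub, so each stub
statement is given a name-keyed `abbrev` whose body is the stub's signature VERBATIM (the wiring
`example` at the end of the file checks the match by elaboration). -/
namespace Registered

/-- **S1 `RectilinearInvariance`** — the statement of `stub_rectilinearInvariance`, verbatim:
asymptotic conformal invariance of bond-ℤ² crossing probabilities on rectilinear pairs of equal
modulus, difference form. [folklore] -/
abbrev stub_rectilinearInvariance : Prop :=
  ∀ (Q Q' : Literature.Probability.RandomPlanarGeometry.ConformalRectangle), (∃ S : Finset (ℂ × ℂ), (∀ p ∈ S, p.1.re = p.2.re ∨ p.1.im = p.2.im) ∧ frontier Q.carrier ⊆ ⋃ p ∈ S, segment ℝ p.1 p.2) → (∃ S : Finset (ℂ × ℂ), (∀ p ∈ S, p.1.re = p.2.re ∨ p.1.im = p.2.im) ∧ frontier Q'.carrier ⊆ ⋃ p ∈ S, segment ℝ p.1 p.2) → ∀ (ψ : Literature.Probability.RandomPlanarGeometry.ConformalEquiv UpperHalfPlane.upperHalfPlaneSet Q.carrier)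 (y : Fin 4 → ℝ) (ψ' : Literature.Probability.RandomPlanarGeometry.ConformalEquiv UpperHalfPlane.upperHalfPlaneSet Q'.carrier) (y' : Fin 4 → ℝ), Q.IsUniformizing ψ y → Q'.IsUniformizing ψ' y' → Literature.Probability.RandomPlanarGeometry.crossRatio y = Literature.Probability.RandomPlanarGeometry.crossRatio y' → Filter.Tendsto (fun δ : ℝ ↦ Literature.Probability.Percolation.bondDomainCrossingProb Q δ - Literature.Probability.Percolation.bondDomainCrossingProb Q' δ) (nhdsWithin (0 : ℝ) (Set.Ioi 0)) (nhds 0)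

/-- **S2 `DomainContinuity`** — the statement of `stub_domainContinuity`, verbatim: mesh-uniform
continuity of the lattice crossing probability in the marked-loop topology. [folklore] -/
abbrev stub_domainContinuity : Prop :=
  ∀ R : Literature.Probability.RandomPlanarGeometry.ConformalRectangle, ∀ τ : ℝ, 0 < τ → ∃ ε₀ : ℝ, 0 < ε₀ ∧ ∀ Q : Literature.Probability.RandomPlanarGeometry.ConformalRectangle, (∀ u : ℝ, dist (Q.boundary u) (R.boundary u) ≤ ε₀) → (∀ i : Fin 4, |Q.mark i - R.mark i| ≤ ε₀) → ∀ᶠ δ in nhdsWithin (0 : ℝ) (Set.Ioi 0), |Literature.Probability.Percolation.bondDomainCrossingProb Q δ - Literature.Probability.Percolation.bondDomainCrossingProb R δ| ≤ τ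

/-- **S3 `RectilinearRealisation`** — the statement of `stub_rectilinearRealisation`, verbatim:
exact-modulus rectilinear approximation of a conformal rectangle. [folklore] -/
abbrev stub_rectilinearRealisation : Prop :=
  ∀ (R : Literature.Probability.RandomPlanarGeometry.ConformalRectangle) (φ : Literature.Probability.RandomPlanarGeometry.ConformalEquiv UpperHalfPlane.upperHalfPlaneSet R.carrier) (x : Fin 4 → ℝ), R.IsUniformizing φ x → ∀ ε₀ : ℝ, 0 < ε₀ → ∃ (Q : Literature.Probability.RandomPlanarGeometry.ConformalRectangle) (ψ : Literature.Probability.RandomPlanarGeometry.ConformalEquiv UpperHalfPlane.upperHalfPlaneSet Q.carrier) (y : Fin 4 → ℝ), (∃ S : Finset (ℂ × ℂ), (∀ p ∈ S, p.1.re = p.2.re ∨ p.1.im = p.2.im) ∧ frontier Q.carrier ⊆ ⋃ p ∈ S, segment ℝ p.1 p.2) ∧ Q.IsUniformizing ψ y ∧ (∀ u : ℝ, dist (Q.boundary u) (R.boundary u) ≤ ε₀) ∧ (∀ i : Fin 4, |Q.mark i - R.mark i| ≤ ε₀) ∧ Literature.Probability.RandomPlanarGeometry.crossRatio y = Literature.Probability.RandomPlanarGeometry.crossRatio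 x

end Registered

/-! ### The abstract gluing lemma (proved): limits transport across asymptotically matched approximants -/

/-- **Four-corner transport of a limit (proved; the bookkeeping of the line).** Let `p, p' : ℝ → ℝ`
and a filter `l`. Suppose that for every `τ > 0` there are `a, a' : ℝ → ℝ` with, `l`-eventually,
`|a - p| ≤ τ` and `|a' - p'| ≤ τ`, and `a - a' → 0` along `l`. If `p → L` along `l` then
`p' → L` along `l`: eventually `|p' - L| ≤ |p' - a'| + |a' - a| + |a - p| + |p - L| < 4τ`. [folklore] -/
theorem tendsto_of_approximants {l : Filter ℝ} {p p' : ℝ → ℝ} {L : ℝ}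
    (h : ∀ τ : ℝ, 0 < τ → ∃ a a' : ℝ → ℝ, (∀ᶠ δ in l, |a δ - p δ| ≤ τ) ∧
      (∀ᶠ δ in l, |a' δ - p' δ| ≤ τ) ∧ Tendsto (fun δ ↦ a δ - a' δ) l (𝓝 0))
    (hp : Tendsto p l (𝓝 L)) : Tendsto p' l (𝓝 L) := by
  rw [Metric.tendsto_nhds]
  intro τ hτ
  have hτ4 : 0 < τ / 4 := by positivity
  obtain ⟨a, a', ha, ha', haa'⟩ := h (τ / 4) hτ4
  have h3 : ∀ᶠ δ in l, dist (a δ - a' δ) 0 < τ / 4 := Metric.tendsto_nhds.1 haa' _ hτ4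
  have h4 : ∀ᶠ δ in l, dist (p δ) L < τ / 4 := Metric.tendsto_nhds.1 hp _ hτ4
  filter_upwards [ha, ha', h3, h4] with δ h1 h2 h3 h4
  rw [Real.dist_eq, sub_zero] at h3
  rw [Real.dist_eq] at h4 ⊢
  obtain ⟨h1l, h1r⟩ := abs_le.1 h1
  obtain ⟨h2l, h2r⟩ := abs_le.1 h2
  obtain ⟨h3l, h3r⟩ := abs_lt.1 h3
  obtain ⟨h4l, h4r⟩ := abs_lt.1 h4
  exact abs_lt.2 ⟨by linarith, by linarith⟩

/-! ### The composition: the three stubs imply the crux, by name -/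

/-- **`ConfInvTransport` from the three stubs** (no `sorry`). Given `R, R'` with data of common
modulus `η` and `bondDomainCrossingProb R δ → L`: for each `τ > 0`, S2 gives closeness scales at `R`
and at `R'`, S3 gives rectilinear `Q` close to `R` and `Q'` close to `R'`, BOTH of modulus exactly
`η`, S1 gives `P_δ(Q) - P_δ(Q') → 0`, and `tendsto_of_approximants` transports the limit. -/
theorem ConfInvTransport_of (h₁ : Registered.stub_rectilinearInvariance)
    (h₂ : Registered.stub_domainContinuity) (h₃ : Registered.stub_rectilinearRealisation) :
    Summit.CriticalPhenomena.CardyFormulaZ2.Theses.CardyHausdorffMoment.ConfInvTransport := by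
  intro R R' φ x φ' x' huni huni' hη L hL
  refine tendsto_of_approximants (fun τ hτ ↦ ?_) hL
  obtain ⟨ε₀, hε₀, hcont⟩ := h₂ R τ hτ
  obtain ⟨ε₀', hε₀', hcont'⟩ := h₂ R' τ hτ
  obtain ⟨Q, ψ, y, hQrect, hQuni, hQloop, hQmark, hQη⟩ := h₃ R φ x huni ε₀ hε₀
  obtain ⟨Q', ψ', y', hQ'rect, hQ'uni, hQ'loop, hQ'mark, hQ'η⟩ := h₃ R' φ' x' huni' ε₀' hε₀'
  have hyy' : crossRatio y = crossRatio y' := by rw [hQη, hQ'η, hη]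
  exact ⟨bondDomainCrossingProb Q, bondDomainCrossingProb Q', hcont Q hQloop hQmark,
    hcont' Q' hQ'loop hQ'mark, h₁ Q Q' hQrect hQ'rect ψ y ψ' y' hQuni hQ'uni hyy'⟩

/-- **Wiring: the registered (sorried) stubs feed `ConfInvTransport_of` as stated** (their
spelled-out signatures are, verbatim, the name-keyed statements `Registered.stub_*`; checked here by
elaboration). This corollary depends on the three `sorry`s through the stub NAMES only; the clean
composition is `ConfInvTransport_of` (axioms `propext`, `Classical.choice`, `Quot.sound`). -/
theorem ConfInvTransport_of_stubs :
    Summit.CriticalPhenomena.CardyFormulaZ2.Theses.CardyHausdorffMoment.ConfInvTransport :=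
  ConfInvTransport_of stub_rectilinearInvariance stub_domainContinuity stub_rectilinearRealisation

end Summit.CriticalPhenomena.CardyFormulaZ2.Cruxes.ConfInvTransport.Birth

end
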